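import Literature.Analysis.FluidPDE.TaoCascadeZeroScaleEarlyRegime
import Literature.Analysis.FluidPDE.TaoCascadeZeroScaleCLower
import Literature.Analysis.FluidPDE.TaoCascadeRescaledBootstrap
import HarnessLib

/-!
# Tao's cascade ODE, §6.7: the time `t_c` ((6.153)–(6.158))

T. Tao, *Finite time blowup for an averaged three-dimensional Navier–Stokes equation*,
J. Amer. Math. Soc. **29** (2016), 601–674 = arXiv:1402.0290v3, §6.7: "let `t_c` be the supremum of
all the times `t ∈ [0, min(T₂, 2)]` for which `|c₀(t')| ≤ K⁻¹⁰ε²` for all `0 ≤ t' ≤ t` … (6.153) … thus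
`1/2 ≤ t_c ≤ min(T₂, 2)` … (6.155) `d₀(t), a₁(t) = O(K⁻¹⁰)`, (6.156) `a₀(t) = 1 + O(K⁻⁹)`,
(6.157) `ε(t - 10⁻⁵ - O(K⁻⁹)) ≤ b₀(t) ≤ ε(t + 10⁻⁵ + O(K⁻⁹))` for all `0 ≤ t ≤ t_c` … `c₀(t) ≳
exp((t²/2 - 10⁻⁵t - 1 + O(K⁻⁹))K^{10})ε²` whenever `1/2 ≤ t ≤ t_c`. Comparing this with (6.153) we
see that `t_c < 2`" (so that, if also `t_c < T₂`, `c₀(t_c) = K⁻¹⁰ε²` (6.158)).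

`RescaledHypotheses.exists_tc` constructs `t_c` (via `maximalTimeP`,
`Literature/Analysis/ODE/MaximalTime.lean`) on an abstract present interval `[0, S]`, `S ≥ 1/2`,
carrying the regime bounds `Ẽ₀, Ẽ₁ ≤ 1`, `Ẽ₋₁ ≤ E₋`, `Ẽ₋₂ ≤ E₂` and the Prop. 6.13 outputs
`|b₁| ≤ B_b`, `|c₁| ≤ B_c`, `|d₁| ≤ B_d`, under explicit smallness hypotheses on the parameters
(the early ceiling of `early_c_ceiling` at `T = 1/2`, the drift `δ ≤ 1/100`, and the growth
inequality making the explicit lower bound of `zero_c_lower_explicit` exceed `K⁻¹⁰ε²` at `t = 2`),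
and records (6.153)–(6.158) on `[0, t_c]` with constants evaluated at `T = 2`. Theorems only; the
discharge of the smallness hypotheses in the regime of Prop. 6.5 is left to the assembly.

## References

* T. Tao, J. Amer. Math. Soc. 29 (2016), 601–674, arXiv:1402.0290v3, §6.7 (6.153)–(6.158).
  [`Tao2016AveragedNS`]
-/

noncomputable section

open Set MeasureTheory intervalIntegral Filter
open scoped _root_.Topology

namespace Literature.Analysis.FluidPDE

namespace TaoCascade

open Literature.Analysis.ODE

section Tc

variable {γ ε₀ K ε C₁ C₂ C₃ : ℝ} {n₀ N : ℤ} {τ : ℤ → ℝ} {Xr : Fin 4 → ℤ → ℝ → ℝ} {Er : ℤ → ℝ → ℝ}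

/-- Monotonicity in `T` of the constant `D(T) = e^{νT}(A + BT)` of `early_regime_bounds`. [folklore] -/
theorem earlyD_mono {ν A B T T' : ℝ} (hν : 0 ≤ ν) (hA : 0 ≤ A) (hB : 0 ≤ B) (hT : 0 ≤ T)
    (hTT' : T ≤ T') : Real.exp (ν * T) * (A + B * T) ≤ Real.exp (ν * T') * (A + B * T') := by
  have h1 : Real.exp (ν * T) ≤ Real.exp (ν * T') :=
    Real.exp_le_exp.2 (mul_le_mul_of_nonneg_left hTT' hν)
  have h2 : A + B * T ≤ A + B * T' := by nlinarith
  exact mul_le_mul h1 h2 (by positivity) (Real.exp_pos _).le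

/-- `|a - 1| ≤ δ ≤ 1` implies `|a² - 1| ≤ 3δ`. [folklore] -/
theorem abs_sq_sub_one_le_three_mul {a δ : ℝ} (h : |a - 1| ≤ δ) (hδ : δ ≤ 1) :
    |a ^ 2 - 1| ≤ 3 * δ := by
  have hδ0 : 0 ≤ δ := (abs_nonneg _).trans h
  have h1 := abs_le.mp h
  rw [abs_le]
  constructor <;> nlinarith

/-- **The time `t_c` of §6.7 and (6.153)–(6.158).** Over `RescaledHypotheses γ …` on `[0, S]`,
`S ≥ 1/2`, with `Ẽ₀, Ẽ₁ ≤ 1`, `Ẽ₋₁ ≤ E₋`, `Ẽ₋₂ ≤ E₂`, `|b₁| ≤ B_b`, `|c₁| ≤ B_c`, `|d₁| ≤ B_d` there,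
`0 < ε ≤ 1`, `γ ≥ 0`, and the early ceiling hypothesis of `early_c_ceiling` at `T = 1/2` with
`C⋆ = K⁻¹⁰ε²`; write `η = C₁(1+ε₀)^{-n₀/2}`, `D₂` = the constant `D` of `early_regime_bounds` at
`T = 2`, `C⋆ = K⁻¹⁰ε²`, `δ = 2·drift` (drift at `T = 2`), `p₂ = 10⁻⁵ε + 2(3εδ + ε⁻¹K^{10}C⋆² + η)`,
`Λ = (ε²e^{-K^{10}}(1-3δ) - η)/100 · e^{-ε⁻¹K^{10}(ε/20000 + p₂/100)} - (1+ε₀)^{-n₀/4}`. If `δ ≤ 1/100`,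
`η ≤ ε²e^{-K^{10}}(1-3δ)` and `K⁻¹⁰ε² < e^{ε⁻¹K^{10}(2ε - 2p₂)}Λ`, then there is `t_c` with
`1/2 ≤ t_c ≤ S`, `t_c < 2`, (6.153) `|c₀| ≤ K⁻¹⁰ε²` on `[0, t_c]`, (6.158) `c₀(t_c) = K⁻¹⁰ε²` if `t_c < S`,
(6.155) `|d₀|, |a₁| ≤ D₂`, (6.156) `|a₀ - 1| ≤ δ`, `∫₀ᵗ a₁² ≤ D₂²t`,
`Ẽ₋₁(t) ≤ Ẽ₋₁(0) + 4K(1+ε₀)^{-5/2}E₂√(2E₋)`, (6.157) `εt - p₂ ≤ b₀ ≤ εt + p₂` on `[0, t_c]`, and the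
growth bound `c₀(t) ≥ e^{ε⁻¹K^{10}(εt²/2 - p₂t)}Λ` on `[1/2, t_c]`, `Λ > 0`.
[cite: Tao2016AveragedNS, §6.7 (6.153)–(6.158)] -/
theorem RescaledHypotheses.exists_tc
    (h : RescaledHypotheses γ ε₀ K ε C₁ C₂ C₃ n₀ N τ Xr Er) (hε : 0 < ε) (hε1 : ε ≤ 1) (hK : 0 < K)
    (hC₁ : 0 ≤ C₁) (hε₀ : 0 < ε₀) (hN : n₀ ≤ N) (hγ : 0 ≤ γ) {S Em E₂ Bb Bc Bd : ℝ} (hS : 1 / 2 ≤ S)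
    (hreg : ∀ t ∈ Icc 0 S, Er 0 t ≤ 1 ∧ Er 1 t ≤ 1 ∧ Er (-1) t ≤ Em ∧ Er (-2) t ≤ E₂)
    (hsec : ∀ t ∈ Icc 0 S, |Xr 1 1 t| ≤ Bb ∧ |Xr 2 1 t| ≤ Bc ∧ |Xr 3 1 t| ≤ Bd)
    (hC : Real.exp (|ε⁻¹ * K ^ 10| * ((1 / 10 ^ 5 * ε + γ * ε ^ 2) * (1 / 2) +
        (Real.sqrt 2 * ε * Real.sqrt 2 ^ 2 + Real.sqrt 2 * (C₁ * (1 + ε₀) ^ (-((n₀ : ℝ) / 2)))) *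
          (1 / 2) ^ 2 / 2)) *
        (γ * ε ^ 2 + (|ε ^ 2 * Real.exp (-K ^ 10)| * 2 + C₁ * (1 + ε₀) ^ (-((n₀ : ℝ) / 2))) * (1 / 2)) ≤
      (K ^ 10)⁻¹ * ε ^ 2) :
    let η : ℝ := C₁ * (1 + ε₀) ^ (-((n₀ : ℝ) / 2))
    let D₂ : ℝ := Real.exp ((1 + ε₀) ^ ((5 : ℝ) / 2) * (ε * Bb + ε ^ 2 * Real.exp (-K ^ 10) * Bc) * 2) *
        ((K ^ 10)⁻¹ + Real.sqrt 2 * (K ^ 15)⁻¹ +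
          ((ε ^ 2)⁻¹ * Real.sqrt 2 * ((K ^ 10)⁻¹ * ε ^ 2) + η +
            ((1 + ε₀) ^ ((5 : ℝ) / 2) * (ε ^ 2)⁻¹ * Bc * Bd + C₁ * (1 + ε₀) ^ (2 - (n₀ : ℝ) / 2))) * 2)
    let δ : ℝ := ((ε ^ 2)⁻¹ * ((K ^ 10)⁻¹ * ε ^ 2) * D₂ +
        (2 * ε + 2 * ε ^ 2 * Real.exp (-K ^ 10) + 2 * K * Em + η)) * 2
    let p₂ : ℝ := 1 / 10 ^ 5 * ε + (ε * (3 * δ) + ε⁻¹ * K ^ 10 * ((K ^ 10)⁻¹ * ε ^ 2) ^ 2 + η) * 2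
    let Λ : ℝ := (ε ^ 2 * Real.exp (-K ^ 10) * (1 - 3 * δ) - η) * (1 / 100) *
        Real.exp (-(ε⁻¹ * K ^ 10 * (ε * (1 / 100) ^ 2 / 2 + p₂ * (1 / 100)))) -
      (1 + ε₀) ^ (-(n₀ : ℝ) / 4)
    δ ≤ 1 / 100 → η ≤ ε ^ 2 * Real.exp (-K ^ 10) * (1 - 3 * δ) →
    (K ^ 10)⁻¹ * ε ^ 2 < Real.exp (ε⁻¹ * K ^ 10 * (ε * 2 ^ 2 / 2 - p₂ * 2)) * Λ →
    ∃ tc : ℝ, 1 / 2 ≤ tc ∧ tc ≤ S ∧ tc < 2 ∧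
      (∀ t ∈ Icc 0 tc, |Xr 2 0 t| ≤ (K ^ 10)⁻¹ * ε ^ 2) ∧
      (tc < S → Xr 2 0 tc = (K ^ 10)⁻¹ * ε ^ 2) ∧
      (∀ t ∈ Icc 0 tc, |Xr 3 0 t| ≤ D₂ ∧ |Xr 0 1 t| ≤ D₂) ∧
      (∀ t ∈ Icc 0 tc, |Xr 0 0 t - 1| ≤ δ) ∧
      (∀ t ∈ Icc 0 tc, ∫ s in (0 : ℝ)..t, Xr 0 1 s ^ 2 ≤ D₂ ^ 2 * t) ∧
      (∀ t ∈ Icc 0 tc, Er (-1) t ≤ Er (-1) 0 +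
        2 * K * (1 + ε₀) ^ (-((5 : ℝ) / 2)) * E₂ * Real.sqrt (2 * Em) * 2) ∧
      (∀ t ∈ Icc 0 tc, ε * t - p₂ ≤ Xr 1 0 t ∧ Xr 1 0 t ≤ ε * t + p₂) ∧
      (∀ t ∈ Icc (1 / 2) tc, Real.exp (ε⁻¹ * K ^ 10 * (ε * t ^ 2 / 2 - p₂ * t)) * Λ ≤ Xr 2 0 t) ∧
      0 < Λ := by
  intro η D₂ δ p₂ Λ hδ hle hgrow
  -- defining equations of the abbreviations, then make them opaque (for tactic performance)
  have hη_def : η = C₁ * (1 + ε₀) ^ (-((n₀ : ℝ) / 2)) := rfl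
  have hD₂_def : D₂ = Real.exp ((1 + ε₀) ^ ((5 : ℝ) / 2) * (ε * Bb + ε ^ 2 * Real.exp (-K ^ 10) * Bc) * 2) *
      ((K ^ 10)⁻¹ + Real.sqrt 2 * (K ^ 15)⁻¹ +
        ((ε ^ 2)⁻¹ * Real.sqrt 2 * ((K ^ 10)⁻¹ * ε ^ 2) + η +
          ((1 + ε₀) ^ ((5 : ℝ) / 2) * (ε ^ 2)⁻¹ * Bc * Bd + C₁ * (1 + ε₀) ^ (2 - (n₀ : ℝ) / 2))) * 2) := rfl
  have hδ_def : δ = ((ε ^ 2)⁻¹ * ((K ^ 10)⁻¹ * ε ^ 2) * D₂ +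
      (2 * ε + 2 * ε ^ 2 * Real.exp (-K ^ 10) + 2 * K * Em + η)) * 2 := rfl
  have hp₂_def : p₂ = 1 / 10 ^ 5 * ε + (ε * (3 * δ) + ε⁻¹ * K ^ 10 * ((K ^ 10)⁻¹ * ε ^ 2) ^ 2 + η) * 2 :=
    rfl
  have hΛ_def : Λ = (ε ^ 2 * Real.exp (-K ^ 10) * (1 - 3 * δ) - η) * (1 / 100) *
      Real.exp (-(ε⁻¹ * K ^ 10 * (ε * (1 / 100) ^ 2 / 2 + p₂ * (1 / 100)))) -
        (1 + ε₀) ^ (-(n₀ : ℝ) / 4) := rfl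
  clear_value η D₂ δ p₂ Λ
  have hτ0 : τ (n₀ - N) ≤ 0 := h.tau_init_le hN
  have hq0 : (0 : ℝ) < 1 + ε₀ := by linarith
  have hη0 : 0 ≤ η := by rw [hη_def]; exact mul_nonneg hC₁ (Real.rpow_nonneg hq0.le _)
  set L : ℝ := (K ^ 10)⁻¹ * ε ^ 2 with hL
  have hL0 : 0 < L := by positivity
  have h0S : (0 : ℝ) ∈ Icc 0 S := ⟨le_rfl, by linarith⟩
  have hBb : 0 ≤ Bb := (abs_nonneg _).trans (hsec 0 h0S).1
  have hBc : 0 ≤ Bc := (abs_nonneg _).trans (hsec 0 h0S).2.1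
  have hBd : 0 ≤ Bd := (abs_nonneg _).trans (hsec 0 h0S).2.2
  have hEm : 0 ≤ Em := (h.nonneg_F (-1) 0 hτ0).trans (hreg 0 h0S).2.2.1
  have hE₂ : 0 ≤ E₂ := (h.nonneg_F (-2) 0 hτ0).trans (hreg 0 h0S).2.2.2
  have hD₂0 : 0 ≤ D₂ := by rw [hD₂_def]; positivity
  have hδ0 : 0 ≤ δ := by rw [hδ_def]; positivity
  have hp₂0 : 0 ≤ p₂ := by rw [hp₂_def]; positivity
  -- positivity of `Λ` from the growth hypothesis
  have hΛ : 0 < Λ := by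
    by_contra hcon
    push Not at hcon
    have : Real.exp (ε⁻¹ * K ^ 10 * (ε * 2 ^ 2 / 2 - p₂ * 2)) * Λ ≤ 0 :=
      mul_nonpos_of_nonneg_of_nonpos (Real.exp_pos _).le hcon
    linarith
  -- the maximal time
  set b : ℝ := min S 2 with hb
  have hb12 : 1 / 2 ≤ b := le_min hS (by norm_num)
  have hb0 : (0 : ℝ) ≤ b := by linarith
  have hbS : b ≤ S := min_le_left _ _
  have hb2 : b ≤ 2 := min_le_right _ _
  -- (6.153) on `[0, 1/2]` from the early ceiling
  have hhalf : ∀ t ∈ Icc (0 : ℝ) (1 / 2), |Xr 2 0 t| ≤ L := by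
    intro t ht
    have hreg' : ∀ s ∈ Icc (0 : ℝ) (1 / 2), Er 0 s ≤ 1 := fun s hs =>
      (hreg s ⟨hs.1, hs.2.trans hS⟩).1
    exact h.early_c_ceiling hε hε1 hC₁ hε₀ hN hγ hreg' hC ht
  have hP0 : |Xr 2 0 0| ≤ L := hhalf 0 ⟨le_rfl, by norm_num⟩
  have hclosed : ∀ t ∈ Ioc 0 b, (∀ s ∈ Ico 0 t, |Xr 2 0 s| ≤ L) → |Xr 2 0 t| ≤ L := by
    intro t ht hico
    have hcont : ContinuousOn (fun s => |Xr 2 0 s|) (Icc 0 t) :=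
      (h.continuousOn_X 2 0 hτ0).abs
    exact le_of_Ico_of_continuousOn (F := fun s => |Xr 2 0 s|) (c := L) ht.1 hcont hico
  set tc : ℝ := maximalTimeP (fun t => |Xr 2 0 t| ≤ L) 0 b with htc
  have htc_mem : tc ∈ Icc 0 b := maximalTimeP_mem (P := fun t => |Xr 2 0 t| ≤ L) hb0 hP0
  have htc12 : 1 / 2 ≤ tc := le_maximalTimeP (P := fun t => |Xr 2 0 t| ≤ L) ⟨by norm_num, hb12⟩ hhalf
  have hPtc : ∀ t ∈ Icc 0 tc, |Xr 2 0 t| ≤ L := fun t ht =>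
    maximalTimeP_spec (P := fun t => |Xr 2 0 t| ≤ L) hb0 hP0 hclosed ht
  have htcS : tc ≤ S := htc_mem.2.trans hbS
  have htc0 : (0 : ℝ) ≤ tc := htc_mem.1
  have htc2 : tc ≤ 2 := htc_mem.2.trans hb2
  -- regime data on `[0, tc]`
  have hregtc : ∀ t ∈ Icc 0 tc, Er 0 t ≤ 1 ∧ Er 1 t ≤ 1 ∧ Er (-1) t ≤ Em ∧ Er (-2) t ≤ E₂ :=
    fun t ht => hreg t ⟨ht.1, ht.2.trans htcS⟩
  have hsectc : ∀ t ∈ Icc 0 tc, |Xr 1 1 t| ≤ Bb ∧ |Xr 2 1 t| ≤ Bc ∧ |Xr 3 1 t| ≤ Bd :=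
    fun t ht => hsec t ⟨ht.1, ht.2.trans htcS⟩
  have hregtc0 : ∀ t ∈ Icc 0 tc, Er 0 t ≤ 1 := fun t ht => (hregtc t ht).1
  -- (6.155)–(6.156) via `early_regime_bounds` at `T = tc`, constants weakened to `T = 2`
  obtain ⟨hDt, hAt, hIt, hsmall⟩ := h.early_regime_bounds hε hK hC₁ hε₀ hN (Em := Em) (E₂ := E₂)
    (Bb := Bb) (Bc := Bc) (Bd := Bd) (Cstar := L) htc0 hregtc hsectc hPtc
  set Dtc : ℝ := Real.exp ((1 + ε₀) ^ ((5 : ℝ) / 2) * (ε * Bb + ε ^ 2 * Real.exp (-K ^ 10) * Bc) * tc) *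
        ((K ^ 10)⁻¹ + Real.sqrt 2 * (K ^ 15)⁻¹ +
          ((ε ^ 2)⁻¹ * Real.sqrt 2 * L + C₁ * (1 + ε₀) ^ (-((n₀ : ℝ) / 2)) +
            ((1 + ε₀) ^ ((5 : ℝ) / 2) * (ε ^ 2)⁻¹ * Bc * Bd + C₁ * (1 + ε₀) ^ (2 - (n₀ : ℝ) / 2))) * tc)
    with hDtc
  have hDtc0 : 0 ≤ Dtc := by positivity
  -- `D(tc) ≤ D₂`
  have hDmono : Dtc ≤ D₂ := by
    rw [hD₂_def, hη_def, hDtc]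
    exact earlyD_mono (by positivity) (by positivity) (by positivity) htc0 htc2
  -- `drift(tc)·tc ≤ δ ≤ 1/100`
  have hdrift : ((ε ^ 2)⁻¹ * L * Dtc +
      (2 * ε + 2 * ε ^ 2 * Real.exp (-K ^ 10) + 2 * K * Em + C₁ * (1 + ε₀) ^ (-((n₀ : ℝ) / 2)))) * tc ≤
      δ := by
    have h1 : (ε ^ 2)⁻¹ * L * Dtc ≤ (ε ^ 2)⁻¹ * L * D₂ := mul_le_mul_of_nonneg_left hDmono (by positivity)
    have h2 : 0 ≤ (ε ^ 2)⁻¹ * L * Dtc +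
        (2 * ε + 2 * ε ^ 2 * Real.exp (-K ^ 10) + 2 * K * Em + C₁ * (1 + ε₀) ^ (-((n₀ : ℝ) / 2))) := by
      positivity
    rw [hδ_def, hη_def]
    exact mul_le_mul (by linarith) htc2 htc0 (by rw [← hη_def]; positivity)
  have hδ1 : ((ε ^ 2)⁻¹ * L * Dtc +
      (2 * ε + 2 * ε ^ 2 * Real.exp (-K ^ 10) + 2 * K * Em + C₁ * (1 + ε₀) ^ (-((n₀ : ℝ) / 2)))) * tc ≤
      1 := hdrift.trans (hδ.trans (by norm_num))
  obtain ⟨_, hEm1⟩ := hsmall hδ1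
  -- conclusions (6.155), (6.156), `∫ a₁²`, `Ẽ₋₁`
  have hD' : ∀ t ∈ Icc 0 tc, |Xr 3 0 t| ≤ D₂ ∧ |Xr 0 1 t| ≤ D₂ := fun t ht =>
    ⟨(hDt t ht).1.trans hDmono, (hDt t ht).2.trans hDmono⟩
  have hA' : ∀ t ∈ Icc 0 tc, |Xr 0 0 t - 1| ≤ δ := fun t ht => (hAt t ht).trans hdrift
  have hI' : ∀ t ∈ Icc 0 tc, ∫ s in (0 : ℝ)..t, Xr 0 1 s ^ 2 ≤ D₂ ^ 2 * t := fun t ht =>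
    (hIt t ht).trans (mul_le_mul_of_nonneg_right (pow_le_pow_left₀ hDtc0 hDmono 2) ht.1)
  have hE' : ∀ t ∈ Icc 0 tc, Er (-1) t ≤ Er (-1) 0 +
      2 * K * (1 + ε₀) ^ (-((5 : ℝ) / 2)) * E₂ * Real.sqrt (2 * Em) * 2 := by
    intro t ht
    have h1 := hEm1 t ht
    have h2 : 2 * K * (1 + ε₀) ^ (-((5 : ℝ) / 2)) * E₂ * Real.sqrt (2 * Em) * tc ≤
        2 * K * (1 + ε₀) ^ (-((5 : ℝ) / 2)) * E₂ * Real.sqrt (2 * Em) * 2 :=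
      mul_le_mul_of_nonneg_left htc2 (by positivity)
    linarith only [h1, h2]
  -- `|a₀² - 1| ≤ 3δ` on `[0, tc]`
  have hA2 : ∀ t ∈ Icc 0 tc, |Xr 0 0 t ^ 2 - 1| ≤ 3 * δ := fun t ht =>
    abs_sq_sub_one_le_three_mul (hA' t ht) (hδ.trans (by norm_num))
  have hAlo : ∀ s ∈ Icc 0 tc, 1 - 3 * δ ≤ Xr 0 0 s ^ 2 := fun s hs => by
    linarith only [(abs_le.mp (hA2 s hs)).1]
  -- (6.157) with `p₂`
  have hptc : 1 / 10 ^ 5 * ε + (ε * (3 * δ) + ε⁻¹ * K ^ 10 * L ^ 2 + C₁ * (1 + ε₀) ^ (-((n₀ : ℝ) / 2))) *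
      tc ≤ p₂ := by
    have h0 : (0 : ℝ) ≤ ε * (3 * δ) + ε⁻¹ * K ^ 10 * L ^ 2 + C₁ * (1 + ε₀) ^ (-((n₀ : ℝ) / 2)) := by
      positivity
    have h1 := mul_le_mul_of_nonneg_left htc2 h0
    rw [hp₂_def, hη_def]
    linarith only [h1]
  have hB' : ∀ t ∈ Icc 0 tc, ε * t - p₂ ≤ Xr 1 0 t ∧ Xr 1 0 t ≤ ε * t + p₂ := by
    intro t ht
    have hba := h.zero_b_affine hε hC₁ hε₀ hN htc0 hregtc0 hA2 hPtc ht
    constructor <;> linarith only [hba.1, hba.2, hptc]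
  -- the growth lower bound on `[1/2, tc]` via `c_lower_of_affine_rate` with `p₂`
  have hgrowth : ∀ t ∈ Icc (1 / 2) tc,
      Real.exp (ε⁻¹ * K ^ 10 * (ε * t ^ 2 / 2 - p₂ * t)) * Λ ≤ Xr 2 0 t := by
    intro t ht
    have ht0 : t ∈ Icc 0 tc := ⟨by linarith only [ht.1], ht.2⟩
    have hX : 0 ≤ (ε ^ 2 * Real.exp (-K ^ 10) * (1 - 3 * δ) - η) * (1 / 100) *
        Real.exp (-(ε⁻¹ * K ^ 10 * (ε * (1 / 100) ^ 2 / 2 + p₂ * (1 / 100)))) -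
          (1 + ε₀) ^ (-(n₀ : ℝ) / 4) := by rw [← hΛ_def]; exact hΛ.le
    have key := c_lower_of_affine_rate (h.continuousOn_X 2 0 hτ0)
      (fun s hs => h.hasDeriv_X 2 0 (hτ0.trans hs.1)) (h.continuousOn_X 1 0 hτ0)
      (μ := ε⁻¹ * K ^ 10) (σ := ε) (p := p₂)
      (lam₀ := ε ^ 2 * Real.exp (-K ^ 10) * (1 - 3 * δ)) (η₂ := η)
      (η' := (1 + ε₀) ^ (-(n₀ : ℝ) / 4)) (a := 0) (b := tc) (by positivity) ?_
      (fun s hs => by have := (hB' s hs).1; rw [sub_zero]; linarith only [this])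
      (fun s hs => by have := (hB' s hs).2; rw [sub_zero]; linarith only [this])
      hε.le hp₂0 (by simpa using h.c_ge) hle ht0 (w := 1 / 100) (by norm_num)
      (by rw [sub_zero]; linarith only [ht.1]) hX
    · rw [hΛ_def]
      simpa only [sub_zero] using key
    · intro s hs
      have hs' : s ∈ Icc 0 tc := Ico_subset_Icc_self hs
      have he := (abs_le.mp (h.eq_c_zero hC₁ (by linarith) (hτ0.trans hs.1) (hregtc0 s hs'))).1
      have hsrc : ε ^ 2 * Real.exp (-K ^ 10) * (1 - 3 * δ) ≤ ε ^ 2 * Real.exp (-K ^ 10) * Xr 0 0 s ^ 2 :=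
        mul_le_mul_of_nonneg_left (hAlo s hs') (by positivity)
      show _ ≤ derivWithin (Xr 2 0) (Ici (τ (n₀ - N))) s
      rw [hη_def]
      linarith only [he, hsrc]
  -- `tc < 2`
  have htc_lt2 : tc < 2 := by
    rcases lt_or_eq_of_le htc2 with hlt | heq
    · exact hlt
    · exfalso
      have h2mem : (2 : ℝ) ∈ Icc (1 / 2) tc := ⟨by norm_num, heq.ge⟩
      have h2mem' : (2 : ℝ) ∈ Icc 0 tc := ⟨by norm_num, heq.ge⟩
      have hlow := hgrowth 2 h2mem
      have hP2 : |Xr 2 0 2| ≤ L := hPtc 2 h2mem'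
      have hup : Xr 2 0 2 ≤ L := (le_abs_self _).trans hP2
      linarith only [hlow, hup, hgrow]
  -- exit: `c₀(tc) = K⁻¹⁰ε²` when `tc < S`
  have hexit : tc < S → Xr 2 0 tc = L := by
    intro hlt
    have htcb : tc < b := lt_min hlt htc_lt2
    have hne := not_eventually_of_maximalTimeP_lt (P := fun t => |Xr 2 0 t| ≤ L) hb0 hP0 htcb
    have habs : |Xr 2 0 tc| = L := by
      refine le_antisymm (hPtc tc ⟨htc0, le_rfl⟩) ?_
      by_contra hcon
      push Not at hcon
      apply hne
      have hcw : ContinuousWithinAt (Xr 2 0) (Icc 0 b) tc :=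
        (h.continuousOn_X 2 0 hτ0) tc htc_mem
      have hcw' : Tendsto (fun s => |Xr 2 0 s|) (𝓝[Icc 0 b] tc) (nhds |Xr 2 0 tc|) :=
        hcw.tendsto.abs
      exact (hcw'.eventually_lt_const hcon).mono fun s hs => hs.le
    have hpos : 0 < Xr 2 0 tc := by
      have hlow := hgrowth tc ⟨htc12, le_rfl⟩
      have : 0 < Real.exp (ε⁻¹ * K ^ 10 * (ε * tc ^ 2 / 2 - p₂ * tc)) * Λ := by positivity
      linarith only [hlow, this]
    rw [← habs, abs_of_pos hpos]
  exact ⟨tc, htc12, htcS, htc_lt2, hPtc, hexit, hD', hA', hI', hE', hB', hgrowth, hΛ⟩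

end Tc

end TaoCascade

end Literature.Analysis.FluidPDE
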